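import Summits.CriticalPhenomena.PercolationContinuityZ3.Theorems.PercNearOneGluingNoHeavyQuantTwoBlobTopFlippedLightHeavy
import HarnessLib

/-!
# QUANT lane R8, T-DEC, leg (III) / PM⁻ two-budget piece route: the POINT PIECES — a self-sufficient atom `k` of `ν = gate_q μ` sliced by the blob
# `(a, g)` and charged a share `u` of the gate-zero mass: the three-atom law `uδ₀ + (1−g)δ_k + gδ_{k+a}` (free masses), single-low and `k`-low cells

builds on p205010 (kernel theorem, internal audit signed; external expert review pending)

Support file (`--supports stmt-CriticalPhenomena-4575`), QUANT lane seat prim-quant-arm-1 (gen 38), rung R8 of `run/shared/lean/prim/quant/LADDER.md`;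
lead ruling V298 (PM⁻ programme of record = the two-budget piece route).  Memo `run/shared/lean/prim/quant/prim-quant-arm-1-g38/PM-TRANSPORT-CELL-G38.md`
§6.5: in the exact census (lead's set, multi-low P) the PLAIN pieces that absorb gate-zero mass are exactly the sliced POINT components of ν's datum
(shapes LGG 115, LMG 69, LG 51, LLM 26, LLG 15, LMM 2 of 278 on tree laws; no sliced pair component ever absorbs on trees).  Companion of
`…QuantTwoBlobGateCell` / `…TwoBlobGateCellTwoLow` (the zero pieces) and `…QuantGateSlicePieces` (the reassembly).  Theorems only, standard axioms,
no sorries, no definitions.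

THE LAW.  `Π = m₀δ₀ + m_kδ_k + m_tδ_{k+a}` (`1 ≤ a`, `1 ≤ k`; in the route `m₀ = u`, `m_k = 1−g`, `m_t = g`, normalised), at a prescribed floor `0 < y < 1`,
target `0 < t`, layer `j`.
* **`LawDec.threeAtom_decAtT_singleLow`** — `k` self-sufficient (`t ≤ 2k ∨ j+1 ≤ k`): DEC ⟸ the capacity inequality `(y/(1−y))m₀ ≤ C_k m_k + C_{k+a} m_t`
  (`C = capCoef y t j 0 ·`; typer g23's `decAtT_singleLow_iff`, sums evaluated).
* **`LawDec.threeAtom_decAtT_lowMid`** — `k` low (`k ≤ j`, `2k < t`), the top `k + a` the only absorber: DEC ⟸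
  `usage(0,k+a)·m₀ + usage(k,k+a)·m_k ≤ m_t` with the two compatibilities (`k+a ≥ j+1`, or `t < k+a` resp. `t < 2k+a` for the charged flows)
  (flow normal form `decAtT_of_flowAtT`, typer g22).

[this work]; DEC rules ARCH-TREES-G49 §2.2 / DEC-TAMP-G50 §3.1 — this lane.  Nothing here is cited as a published result.  The gluing rows served
[cite: KozmaNitzan2024, Conjecture 3 (p. 15)]; product measure [cite: Grimmett1999, §1.3 p. 10].
-/

noncomputable section

namespace Summit.CriticalPhenomena.PercolationContinuityZ3.Theorems

namespace Quant

open Finset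

/-- the three-atom law `m₀δ₀ + m_k δ_k + m_t δ_{k+a}` evaluated at `h` -/
local notation3 "ATOM3[" a ", " k ", " m0 ", " mk ", " mt ", " h "]" =>
  (m0 : ℝ) * (if (h : ℕ) = 0 then (1 : ℝ) else 0) + (mk : ℝ) * (if (h : ℕ) = (k : ℕ) then (1 : ℝ) else 0)
    + (mt : ℝ) * (if (h : ℕ) = (k : ℕ) + (a : ℕ) then (1 : ℝ) else 0)

namespace LawDec

/-- **POINT PIECE, SINGLE-LOW** (`k` self-sufficient at `(t, j)`): the capacity inequality `(y/(1−y))m₀ ≤ C_k m_k + C_{k+a} m_t` gives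
`DECAtT y t j (k + a) (m₀δ₀ + m_kδ_k + m_tδ_{k+a})`. [this work] -/
theorem threeAtom_decAtT_singleLow (y t m0 mk mt : ℝ) (j a k : ℕ) (hy0 : 0 < y) (hy1 : y < 1)
    (hm0 : 0 ≤ m0) (hmk : 0 ≤ mk) (hmt : 0 ≤ mt) (hsum : m0 + mk + mt = 1) (ht : 0 < t) (ha : 1 ≤ a)
    (hkS : t ≤ 2 * (k : ℝ) ∨ j + 1 ≤ k)
    (hcap : y / (1 - y) * m0 ≤ capCoef y t j 0 k * mk + capCoef y t j 0 (k + a) * mt) :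
    DECAtT y t j (k + a) (fun h => ATOM3[a, k, m0, mk, mt, h]) := by
  classical
  have ind_nn : ∀ (P : Prop) [Decidable P], (0:ℝ) ≤ (if P then (1:ℝ) else 0) := fun P _ => by split_ifs <;> norm_num
  have hk0 : k ≠ 0 := by
    rintro rfl
    rcases hkS with h2 | hg
    · simp at h2; linarith
    · omega
  have hnotlow : ∀ l, l ≤ j → 2 * (l : ℝ) < t → l ≠ k ∧ l ≠ k + a := by
    intro l hlj hl
    refine ⟨?_, ?_⟩
    · rintro rfl
      rcases hkS with h2 | hg
      · linarith
      · omega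
    · rintro rfl
      rcases hkS with h2 | hg
      · push_cast at hl; linarith [(Nat.cast_nonneg a : (0:ℝ) ≤ a)]
      · omega
  have hlaw0 : ∀ h, 0 ≤ ATOM3[a, k, m0, mk, mt, h] := by
    intro h
    have := mul_nonneg hm0 (ind_nn (h = 0)); have := mul_nonneg hmk (ind_nn (h = k)); have := mul_nonneg hmt (ind_nn (h = k + a))
    linarith
  have hlawM : ∀ h, k + a < h → ATOM3[a, k, m0, mk, mt, h] = 0 := by
    intro h hh
    rw [if_neg (by omega), if_neg (by omega), if_neg (by omega)]
    ring
  have hlaw1 : ∑ h ∈ Finset.range (k + a + 1), ATOM3[a, k, m0, mk, mt, h] = 1 := by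
    rw [Finset.sum_add_distrib, Finset.sum_add_distrib, BlobDec2.sum_range_const_indicator _ 0 (Nat.zero_le _) m0,
      BlobDec2.sum_range_const_indicator _ k (Nat.le_add_right k a) mk, BlobDec2.sum_range_const_indicator _ (k + a) le_rfl mt]
    exact hsum
  have hsingle : ∀ l, l ≤ j → 2 * (l : ℝ) < t → l ≠ 0 → ATOM3[a, k, m0, mk, mt, l] = 0 := by
    intro l hlj hl hl0
    obtain ⟨h1, h2⟩ := hnotlow l hlj hl
    rw [if_neg hl0, if_neg h1, if_neg h2]
    ring
  have hcap' : y / (1 - y) * ATOM3[a, k, m0, mk, mt, 0] ≤ ∑ h ∈ Finset.range (k + a + 1), capCoef y t j 0 h * ATOM3[a, k, m0, mk, mt, h] := by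
    have e0 : ATOM3[a, k, m0, mk, mt, 0] = m0 := by
      rw [if_pos rfl, if_neg (Ne.symm hk0), if_neg (by omega)]
      ring
    have esum : ∑ h ∈ Finset.range (k + a + 1), capCoef y t j 0 h * ATOM3[a, k, m0, mk, mt, h] =
        capCoef y t j 0 0 * m0 + capCoef y t j 0 k * mk + capCoef y t j 0 (k + a) * mt := by
      simp only [mul_add]
      rw [Finset.sum_add_distrib, Finset.sum_add_distrib]
      rw [sum_range_mul_const_indicator _ 0 (Nat.zero_le _), sum_range_mul_const_indicator _ k (Nat.le_add_right k a),
        sum_range_mul_const_indicator _ (k + a) le_rfl]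
    rw [e0, esum, capCoef_zero_self y t j ht, zero_mul, zero_add]
    exact hcap
  exact (decAtT_singleLow_iff y t j (k + a) 0 _ hy0 hy1 hlaw0 hlawM hlaw1 (Nat.zero_le j) (by simpa using ht) hsingle).2 hcap'

/-- **POINT PIECE WITH `k` LOW** (`1 ≤ k ≤ j`, `2k < t`, `1 ≤ a`): the top `k + a` absorbs both lows; flows `0 ↦ k+a` (all of `m₀`, compatible:
`k + a ≥ j+1` or `t < k + a` when `m₀ > 0`) and `k ↦ k+a` (all of `m_k`, compatible: `k + a ≥ j+1` or `t < 2k + a` when `m_k > 0`), the top self-sufficient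
(`t ≤ 2(k+a) ∨ j+1 ≤ k+a`); if `usage(0,k+a)·m₀ + usage(k,k+a)·m_k ≤ m_t` then `DECAtT y t j (k + a) (m₀δ₀ + m_kδ_k + m_tδ_{k+a})`. [this work] -/
theorem threeAtom_decAtT_lowMid (y t m0 mk mt : ℝ) (j a k : ℕ) (hy0 : 0 < y) (hy1 : y < 1)
    (hm0 : 0 ≤ m0) (hmk : 0 ≤ mk) (hsum : m0 + mk + mt = 1) (ha : 1 ≤ a) (hk : 1 ≤ k) (hkj : k ≤ j) (hklow : 2 * (k : ℝ) < t)
    (htS : t ≤ 2 * ((k : ℝ) + a) ∨ j + 1 ≤ k + a)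
    (hs0 : 0 < m0 → j + 1 ≤ k + a ∨ t < (k : ℝ) + a) (hsk : 0 < mk → j + 1 ≤ k + a ∨ t < (k : ℝ) + ((k : ℝ) + a))
    (hload : usage y t j 0 (k + a) * m0 + usage y t j k (k + a) * mk ≤ mt) :
    DECAtT y t j (k + a) (fun h => ATOM3[a, k, m0, mk, mt, h]) := by
  classical
  have ind_nn : ∀ (P : Prop) [Decidable P], (0:ℝ) ≤ (if P then (1:ℝ) else 0) := fun P _ => by split_ifs <;> norm_num
  have ht0 : 0 < t := by linarith [(Nat.cast_nonneg k : (0:ℝ) ≤ k)]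
  set f : ℕ → ℕ → ℝ := fun l h =>
    ((if l = 0 then (1:ℝ) else 0) * m0 + (if l = k then (1:ℝ) else 0) * mk) * (if h = k + a then (1:ℝ) else 0) with hf
  have hlawM : ∀ h, k + a < h → ATOM3[a, k, m0, mk, mt, h] = 0 := by
    intro h hh
    rw [if_neg (by omega), if_neg (by omega), if_neg (by omega)]
    ring
  have hlaw1 : ∑ h ∈ Finset.range (k + a + 1), ATOM3[a, k, m0, mk, mt, h] = 1 := by
    rw [Finset.sum_add_distrib, Finset.sum_add_distrib, BlobDec2.sum_range_const_indicator _ 0 (Nat.zero_le _) m0,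
      BlobDec2.sum_range_const_indicator _ k (Nat.le_add_right k a) mk, BlobDec2.sum_range_const_indicator _ (k + a) le_rfl mt]
    exact hsum
  have hrow : ∀ l, ∑ h ∈ Finset.range (k + a + 1), f l h = (if l = 0 then (1:ℝ) else 0) * m0 + (if l = k then (1:ℝ) else 0) * mk := by
    intro l
    simp only [hf]
    rw [BlobDec2.sum_range_const_indicator _ (k + a) le_rfl]
  have hcol : ∀ h, ∑ l ∈ Finset.range (j + 1), usage y t j l h * f l h =
      (usage y t j 0 h * m0 + usage y t j k h * mk) * (if h = k + a then (1:ℝ) else 0) := by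
    intro h
    have e : ∀ l, usage y t j l h * f l h =
        (usage y t j 0 h * m0 * (if h = k + a then (1:ℝ) else 0)) * (if l = 0 then (1:ℝ) else 0)
        + (usage y t j k h * mk * (if h = k + a then (1:ℝ) else 0)) * (if l = k then (1:ℝ) else 0) := by
      intro l; simp only [hf]
      by_cases hl0 : l = 0
      · rw [if_pos hl0, if_neg (by omega : l ≠ k), hl0]; ring
      · rw [if_neg hl0]
        by_cases hlk : l = k
        · rw [if_pos hlk, hlk]; ring
        · rw [if_neg hlk]; ring
    simp only [e, Finset.sum_add_distrib]
    rw [BlobDec2.sum_range_const_indicator _ 0 (Nat.zero_le _), BlobDec2.sum_range_const_indicator _ k hkj]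
    ring
  refine decAtT_of_flowAtT y t j (k + a) _ hy0 hy1 hlawM hlaw1 ⟨f, ?_, ?_, ?_, ?_⟩
  · intro l h
    simp only [hf]
    exact mul_nonneg (add_nonneg (mul_nonneg (ind_nn _) hm0) (mul_nonneg (ind_nn _) hmk)) (ind_nn _)
  · intro l h hpos
    simp only [hf] at hpos
    have hh : h = k + a := by
      by_contra hne; rw [if_neg hne, mul_zero] at hpos; exact lt_irrefl _ hpos
    rw [if_pos hh, mul_one] at hpos
    by_cases hl0 : l = 0
    · rw [if_pos hl0, if_neg (by omega : l ≠ k), one_mul, zero_mul, add_zero] at hpos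
      subst hl0
      refine ⟨Nat.zero_le _, by simpa using ht0, by omega, ?_⟩
      rcases hs0 hpos with hg | hc
      · exact Or.inl (by omega)
      · refine Or.inr ?_; rw [hh]; push_cast; linarith
    · rw [if_neg hl0, zero_mul, zero_add] at hpos
      by_cases hlk : l = k
      · rw [if_pos hlk, one_mul] at hpos
        subst hlk
        refine ⟨hkj, hklow, by omega, ?_⟩
        rcases hsk hpos with hg | hc
        · exact Or.inl (by omega)
        · refine Or.inr ?_; rw [hh]; push_cast; linarith
      · rw [if_neg hlk, zero_mul] at hpos; exact absurd hpos (lt_irrefl 0)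
  · intro l hlj hlow
    rw [hrow l]
    change _ = ATOM3[a, k, m0, mk, mt, l]
    have hlt : l ≠ k + a := by
      rintro rfl
      rcases htS with h2 | hg
      · push_cast at hlow; linarith
      · omega
    by_cases hl0 : l = 0
    · have hlk : l ≠ k := by omega
      rw [if_pos hl0, if_neg hlk, if_neg hlt]
      ring
    · rw [if_neg hl0]
      by_cases hlk : l = k
      · rw [if_pos hlk, if_neg hlt]
        ring
      · rw [if_neg hlk, if_neg hlt]
        ring
  · intro h hhM hself
    rw [hcol h]
    change _ ≤ ATOM3[a, k, m0, mk, mt, h]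
    by_cases hh : h = k + a
    · subst hh
      rw [if_pos rfl, mul_one, if_neg (by omega : k + a ≠ 0), if_neg (by omega : k + a ≠ k)]
      linarith [hload]
    · rw [if_neg hh, mul_zero]
      have := mul_nonneg hm0 (ind_nn (h = 0)); have := mul_nonneg hmk (ind_nn (h = k))
      linarith

end LawDec

end Quant

end Summit.CriticalPhenomena.PercolationContinuityZ3.Theorems
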